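import Summits.BirchSwinnertonDyer.BirchSwinnertonDyer.Theorems.ThetaPartnerAtTwoSignedMainConjectureCMTwoRankZeroPTDeepLocalIndexCoprime
import Literature.NumberTheory.EllipticCurves.ZpExtensionUnramifiedProofs
import Literature.NumberTheory.EllipticCurves.NeronOggShafarevichLocal
import Literature.NumberTheory.EllipticCurves.IwasawaSelmerControlLocalInputsProofs
import Literature.NumberTheory.EllipticCurves.SelmerInertia
import Literature.NumberTheory.GaloisRepresentations.EulerSystem
import HarnessLib

/-!
# Route `ThetaPartnerAtTwo` (TP2), crux K2R0P♭ (stmt-BirchSwinnertonDyer-26471; derived node K2r0P 24945), line `rankzero` v19,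
# stub `stub_poitouTateDeepTwoGen` = (S_PT) — brick **B5a″** of `Cruxes/SignedMainConjectureCMTwoRankZeroOfPub/PT-DEEP-HALF-DESIGN-w2g4.md` §7:
# **the local subgroup `D_∞ = Gal(K̄_v/K_{∞,η})` of the `ℤ_p`-tower at `v ∤ p` is PRO-PRIME-TO-`p` over the inertia group**:
# every open subgroup `W ⊇ I_𝔐` of `Γ_{K_v}` meets `D_∞` in a subgroup of index prime to `p` (when `v` does not split completely, e.g. κ cyclotomic)

HONEST FRAMING (cell `pub/bsd-wall`, W-ALL row 1; width seat `bsd-wall-tp2-p2-w2` g4, `--supports` only). THEOREMS ONLY (no definition, no named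
fact, no instance, no `sorry`); sequel of `…PTDeepLocalIndexCoprime.lean` ((L1): `Γ_{K_v}/I_𝔐` abelian); closes no item; BSD is NOT proved by any of this.

## What is proved (`K` a number field, `v` a finite place, `𝔐 ∈ v.localPrimesAbove`, `F` an arithmetic Frobenius at `𝔐`; in §2 also a prime `p`, a
## `ℤ_p`-extension `κ`, `p ∉ 𝓂_v`, `D_∞ := localSubgroup κ.kerSubgroup K_v`, `D_M := localSubgroup (κ.layerSubgroup M) K_v`)

* §1 (L2) `zpowers_mk_frobenius_eq_top`, `index_eq_orderOf_mk_frobenius`, `pow_mem_iff_orderOf_dvd` — for an open `U ⊇ I_𝔐`: `Γ_{K_v} ⧸ U` is cyclic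
  on `F`, `[Γ_{K_v} : U] = orderOf (F mod U)`, `F^m ∈ U ↔ orderOf ∣ m`.
* §2 `padicInt_eq_zero_of_forall_pow_dvd`; `inertia_le_localSubgroup_kerSubgroup` (`I_𝔐 ≤ D_∞`, unramifiedness of `ℤ_p`-towers at `v ∤ p`);
  `mem_localSubgroup_kerSubgroup_iff` / `mem_localSubgroup_layerSubgroup_iff` (membership through the additive character `χ = toAdd ∘ κ ∘ res`);
  `exists_localSubgroup_layerSubgroup_le` (**`D_M ≤ V` for some `M`** whenever `V ⊇ D_∞` is open — compactness);
  (F1) `exists_index_eq_prime_pow` (**every open `V ⊇ D_∞` has `p`-power index**, given `F ∉ D_∞`);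
  (L3′)+(L4) **`relIndex_localSubgroup_kerSubgroup_coprime`**: for every open `W ⊇ I_𝔐`, `[D_∞ : W ⊓ D_∞]` is prime to `p` (given `F ∉ D_∞`).
  Proof: `[Γ : W] = p^s f'`, `[Γ : W ⊔ D_∞] = p^r` with `r ≤ s`; `F^{p^r} = w d`, `w = F^j τ u` modulo an open normal `U₀ ≤ W ⊓ D_N` (`N = s + v_p(χ F) + 1`)
  gives `p^s ∣ j` and `p^N ∣ χ u = (p^r − j)·χ F`, whence `p^{s+1} ∣ p^r − j` in `ℤ` (`PadicInt.pow_p_dvd_int_iff`, `unitCoeff_spec`) — impossible if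
  `r < s`; so `r = s` and `[D_∞ : W ⊓ D_∞] = [W ⊔ D_∞ : W] = f'`.

With `…PTDeepCoprimeRes.resOfLe_injective_of_forall_isOpen_sup_coprime` (`A := I_𝔐`, `B := D_∞`): an `E[p^∞]`-class over `K_{∞,η}` that is unramified
at `v ∤ p` is ZERO (Greenberg, LNM 1716, §2 p. 70) — the input of B5b.

References: [GreenbergLNM1716] §2 (p. 70), §3 Lemma 3.2 (p. 86); [NeukirchANT1999] Ch. II §9 Prop. (9.9)–(9.11); [Washington1997] Prop. 13.2 (ℤ_p-extensions are
unramified outside p).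
-/

set_option autoImplicit false
-- the Theorems namespace of this sub repeats the summit name by design (D-0017 nested layout)
set_option linter.dupNamespace false

noncomputable section

open scoped Classical NumberField Pointwise

universe u

namespace Summit.BirchSwinnertonDyer.BirchSwinnertonDyer.Theorems

namespace SignedLowerOffTwo.PTDeep

open NumberField IsDedekindDomain Field IsDedekindDomain.HeightOneSpectrum
  Literature.NumberTheory.EllipticCurves Literature.NumberTheory.GaloisRepresentations

variable {K : Type u} [Field K] [NumberField K] (v : HeightOneSpectrum (𝓞 K))

/-! ## (L2) The finite quotients `Γ_{K_v} ⧸ U` (`U ⊇ I_𝔐` open) are cyclic on the Frobenius -/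

section Frobenius

variable {𝔐 : Ideal (localAbsIntegers v)} {F : absoluteGaloisGroup (v.adicCompletion K)}

/-- For an open subgroup `U ⊇ I_𝔐` (normal by `normal_of_inertia_le_local`), every element of `Γ_{K_v} ⧸ U` is a power of the image of
an arithmetic Frobenius `F` (Frobenius generation `exists_eq_frobenius_pow_mul_inertia_mul`). [cite: NeukirchANT1999, Ch. II §9 Prop. (9.9)–(9.11)] -/
theorem zpowers_mk_frobenius_eq_top (h𝔐 : 𝔐 ∈ v.localPrimesAbove) (hF : IsArithFrobAt (v.adicCompletionIntegers K) F 𝔐)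
    {U : Subgroup (absoluteGaloisGroup (v.adicCompletion K))} [U.Normal]
    (hU : IsOpen (U : Set (absoluteGaloisGroup (v.adicCompletion K))))
    (hIU : 𝔐.inertia (absoluteGaloisGroup (v.adicCompletion K)) ≤ U) :
    Subgroup.zpowers (QuotientGroup.mk F : absoluteGaloisGroup (v.adicCompletion K) ⧸ U) = ⊤ := by
  rw [eq_top_iff]
  rintro q -
  obtain ⟨σ, rfl⟩ := QuotientGroup.mk_surjective q
  obtain ⟨n, τ, u, hτ, hu, rfl⟩ := exists_eq_frobenius_pow_mul_inertia_mul v h𝔐 hF hU σ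
  refine ⟨n, ?_⟩
  show (QuotientGroup.mk F : absoluteGaloisGroup (v.adicCompletion K) ⧸ U) ^ (n : ℤ) = _
  rw [zpow_natCast, QuotientGroup.mk_mul, QuotientGroup.mk_mul, (QuotientGroup.eq_one_iff τ).mpr (hIU hτ),
    (QuotientGroup.eq_one_iff u).mpr hu, mul_one, mul_one, QuotientGroup.mk_pow]

/-- **`[Γ_{K_v} : U]` is the order of the Frobenius in `Γ_{K_v} ⧸ U`** for an open `U ⊇ I_𝔐`. [cite: NeukirchANT1999, Ch. II §9 Prop. (9.9)–(9.11)] -/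
theorem index_eq_orderOf_mk_frobenius (h𝔐 : 𝔐 ∈ v.localPrimesAbove) (hF : IsArithFrobAt (v.adicCompletionIntegers K) F 𝔐)
    {U : Subgroup (absoluteGaloisGroup (v.adicCompletion K))} [U.Normal]
    (hU : IsOpen (U : Set (absoluteGaloisGroup (v.adicCompletion K))))
    (hIU : 𝔐.inertia (absoluteGaloisGroup (v.adicCompletion K)) ≤ U) :
    U.index = orderOf (QuotientGroup.mk F : absoluteGaloisGroup (v.adicCompletion K) ⧸ U) := by
  rw [Subgroup.index_eq_card, ← Nat.card_zpowers, zpowers_mk_frobenius_eq_top v h𝔐 hF hU hIU, Subgroup.card_top]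

/-- `F^m ∈ U ↔ orderOf (F mod U) ∣ m` for an open `U ⊇ I_𝔐`. [cite: NeukirchANT1999, Ch. II §9 Prop. (9.9)–(9.11)] -/
theorem pow_mem_iff_orderOf_dvd {U : Subgroup (absoluteGaloisGroup (v.adicCompletion K))} [U.Normal] (m : ℕ) :
    F ^ m ∈ U ↔ orderOf (QuotientGroup.mk F : absoluteGaloisGroup (v.adicCompletion K) ⧸ U) ∣ m := by
  rw [orderOf_dvd_iff_pow_eq_one, ← QuotientGroup.mk_pow, QuotientGroup.eq_one_iff]

end Frobenius

/-! ## (F1), (L3′), (L4) The local subgroup `D_∞` of `Γ_∞` at `v ∤ p`: `D_∞/I_𝔐` is pro-prime-to-`p` when `F ∉ D_∞` -/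

section Tower

variable {p : ℕ} [Fact p.Prime] (κ : ZpExtension K p) {𝔐 : Ideal (localAbsIntegers v)} {F : absoluteGaloisGroup (v.adicCompletion K)}

/-- In `ℤ_p`, an element divisible by every power of `p` is `0`. [folklore] -/
theorem padicInt_eq_zero_of_forall_pow_dvd {x : ℤ_[p]} (h : ∀ M : ℕ, (p : ℤ_[p]) ^ M ∣ x) : x = 0 := by
  by_contra hx
  obtain ⟨c, hc⟩ := h (x.valuation + 1)
  have hc0 : c ≠ 0 := by rintro rfl; exact hx (by rw [hc, mul_zero])
  have hval := PadicInt.valuation_p_pow_mul (x.valuation + 1) c hc0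
  rw [← hc] at hval
  omega

/-- `I_𝔐 ≤ D_∞`: every `ℤ_p`-extension is unramified at `v ∤ p` (tree `ZpExtension.inertia_le_kerSubgroup_holds`, transported to the local
inertia group through `resGalOfEmb_mem_inertia_primeBelow`). [cite: Washington1997, Prop. 13.2] -/
theorem inertia_le_localSubgroup_kerSubgroup (hpv : (p : 𝓞 K) ∉ v.asIdeal) (h𝔐 : 𝔐 ∈ v.localPrimesAbove) :
    𝔐.inertia (absoluteGaloisGroup (v.adicCompletion K)) ≤ localSubgroup κ.kerSubgroup (v.adicCompletion K) := fun σ hσ ↦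
  (mem_localSubgroup_iff _ _ σ).mpr
    (ZpExtension.inertia_le_kerSubgroup_holds K p κ hpv (primeBelow_mem_primesAbove h𝔐)
      (v.resGalOfEmb_mem_inertia_primeBelow (closureEmb (K := K) (v.adicCompletion K)) 𝔐 hσ))

/-- Membership in `D_∞ = localSubgroup κ.kerSubgroup K_v` read on the additive character `χ = toAdd ∘ κ ∘ res`: `σ ∈ D_∞ ↔ χ σ = 0`. [folklore] -/
theorem mem_localSubgroup_kerSubgroup_iff (σ : absoluteGaloisGroup (v.adicCompletion K)) :
    σ ∈ localSubgroup κ.kerSubgroup (v.adicCompletion K) ↔ (κ (resGal (K := K) (v.adicCompletion K) σ)).toAdd = 0 := by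
  rw [mem_localSubgroup_iff, ZpExtension.mem_kerSubgroup, toAdd_eq_zero]

/-- Membership in `D_M = localSubgroup (κ.layerSubgroup M) K_v`: `σ ∈ D_M ↔ p^M ∣ χ σ`. [folklore] -/
theorem mem_localSubgroup_layerSubgroup_iff (M : ℕ) (σ : absoluteGaloisGroup (v.adicCompletion K)) :
    σ ∈ localSubgroup (κ.layerSubgroup M) (v.adicCompletion K) ↔
      (p : ℤ_[p]) ^ M ∣ (κ (resGal (K := K) (v.adicCompletion K) σ)).toAdd := by
  rw [mem_localSubgroup_iff, ZpExtension.mem_layerSubgroup]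

/-- **`D_∞ = ⋂_M D_M` meets every open subgroup `V ⊇ D_∞` at a finite layer: `D_M ≤ V` for some `M`** (compactness of `Γ_{K_v}`; the `D_M` are
closed and decrease to `D_∞`). [cite: GreenbergLNM1716, §3 Lemma 3.2 (p. 86)] -/
theorem exists_localSubgroup_layerSubgroup_le {V : Subgroup (absoluteGaloisGroup (v.adicCompletion K))}
    (hV : IsOpen (V : Set (absoluteGaloisGroup (v.adicCompletion K))))
    (hDV : localSubgroup κ.kerSubgroup (v.adicCompletion K) ≤ V) :
    ∃ M : ℕ, localSubgroup (κ.layerSubgroup M) (v.adicCompletion K) ≤ V := by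
  haveI : CompactSpace (absoluteGaloisGroup (v.adicCompletion K)) := absoluteGaloisGroup_compactSpace (v.adicCompletion K)
  have hVc : IsCompact ((V : Set (absoluteGaloisGroup (v.adicCompletion K)))ᶜ) := hV.isClosed_compl.isCompact
  have hclosed : ∀ M : ℕ, IsClosed ((localSubgroup (κ.layerSubgroup M) (v.adicCompletion K) :
      Subgroup (absoluteGaloisGroup (v.adicCompletion K))) : Set (absoluteGaloisGroup (v.adicCompletion K))) := fun M ↦
    Subgroup.isClosed_of_isOpen _ (isOpen_localSubgroup_layerSubgroup (v.adicCompletion K) κ M)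
  have hanti : ∀ {M M' : ℕ}, M ≤ M' → (localSubgroup (κ.layerSubgroup M') (v.adicCompletion K) :
      Subgroup (absoluteGaloisGroup (v.adicCompletion K))) ≤ localSubgroup (κ.layerSubgroup M) (v.adicCompletion K) :=
    fun h ↦ Subgroup.comap_mono (κ.layerSubgroup_antitone h)
  have hdir : Directed (· ⊇ ·) fun M : ℕ ↦ ((localSubgroup (κ.layerSubgroup M) (v.adicCompletion K) :
      Subgroup (absoluteGaloisGroup (v.adicCompletion K))) : Set (absoluteGaloisGroup (v.adicCompletion K))) :=
    fun i j ↦ ⟨max i j, fun x hx ↦ hanti (le_max_left i j) hx, fun x hx ↦ hanti (le_max_right i j) hx⟩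
  have hempty : ((V : Set (absoluteGaloisGroup (v.adicCompletion K)))ᶜ) ∩
      ⋂ M : ℕ, ((localSubgroup (κ.layerSubgroup M) (v.adicCompletion K) :
        Subgroup (absoluteGaloisGroup (v.adicCompletion K))) : Set (absoluteGaloisGroup (v.adicCompletion K))) = ∅ := by
    refine Set.eq_empty_iff_forall_notMem.mpr fun σ hσ ↦ hσ.1 (hDV ?_)
    rw [mem_localSubgroup_kerSubgroup_iff]
    refine padicInt_eq_zero_of_forall_pow_dvd fun M ↦ ?_
    rw [← mem_localSubgroup_layerSubgroup_iff]
    exact Set.mem_iInter.mp hσ.2 M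
  obtain ⟨M, hM⟩ := hVc.elim_directed_family_closed _ hclosed hempty hdir
  refine ⟨M, fun σ hσ ↦ ?_⟩
  by_contra hσV
  exact (Set.eq_empty_iff_forall_notMem.mp hM) σ ⟨hσV, hσ⟩

/-- **(F1) Every open subgroup `V ⊇ D_∞` of `Γ_{K_v}` has `p`-power index**, provided `F ∉ D_∞` (the place does not split completely in the
`ℤ_p`-tower): `[Γ_{K_v} : V] = orderOf(F mod V) =: p^r·e'`, and `F^{p^r} ∈ V` because `e'·m ≡ 1 (mod p^{M+1})` for some `m`, where `D_{M} ≤ V`: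
`F^{p^r·e'·m} = F^{p^r}·F^{p^{r+M+1} q}` with `F^{em} ∈ V` and `F^{p^{r+M+1}q} ∈ D_M ≤ V`. [cite: GreenbergLNM1716, §3 (p. 86)] [cite: NeukirchANT1999, Ch. II §9 Prop. (9.9)–(9.11)] -/
theorem exists_index_eq_prime_pow (hpv : (p : 𝓞 K) ∉ v.asIdeal) (h𝔐 : 𝔐 ∈ v.localPrimesAbove)
    (hF : IsArithFrobAt (v.adicCompletionIntegers K) F 𝔐)
    {V : Subgroup (absoluteGaloisGroup (v.adicCompletion K))} (hV : IsOpen (V : Set (absoluteGaloisGroup (v.adicCompletion K))))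
    (hDV : localSubgroup κ.kerSubgroup (v.adicCompletion K) ≤ V) :
    ∃ r : ℕ, V.index = p ^ r := by
  classical
  have hp : p.Prime := Fact.out
  haveI : CompactSpace (absoluteGaloisGroup (v.adicCompletion K)) := absoluteGaloisGroup_compactSpace (v.adicCompletion K)
  have hIV : 𝔐.inertia (absoluteGaloisGroup (v.adicCompletion K)) ≤ V := (inertia_le_localSubgroup_kerSubgroup v κ hpv h𝔐).trans hDV
  haveI : V.Normal := normal_of_inertia_le_local v h𝔐 hIV
  haveI : V.FiniteIndex := finiteIndex_of_isOpen_of_compactSpace V hV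
  set e : ℕ := orderOf (QuotientGroup.mk F : absoluteGaloisGroup (v.adicCompletion K) ⧸ V) with he_def
  have he : V.index = e := index_eq_orderOf_mk_frobenius v h𝔐 hF hV hIV
  have he0 : e ≠ 0 := by rw [← he]; exact Subgroup.FiniteIndex.index_ne_zero
  obtain ⟨r, e', he', hee'⟩ := Nat.exists_eq_pow_mul_and_not_dvd he0 p hp.one_lt.ne'
  -- a layer `D_M ≤ V` and a modular inverse of `e'`
  obtain ⟨M, hM⟩ := exists_localSubgroup_layerSubgroup_le v κ hV hDV
  have hcop : Nat.Coprime e' (p ^ (M + 1)) := Nat.Coprime.pow_right (M + 1) ((Nat.Prime.coprime_iff_not_dvd hp).mpr he').symm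
  obtain ⟨m, -, hm⟩ := Nat.exists_mul_mod_eq_one_of_coprime hcop (Nat.one_lt_pow (Nat.succ_ne_zero M) hp.one_lt)
  set q : ℕ := e' * m / p ^ (M + 1) with hq
  have hdecomp : e' * m = p ^ (M + 1) * q + 1 := by
    have := Nat.div_add_mod (e' * m) (p ^ (M + 1))
    rw [hm] at this
    exact this.symm
  -- `F^(e m) ∈ V` and `F^(p^r * p^(M+1) * q) ∈ D_M ≤ V`
  have h1 : F ^ (e * m) ∈ V := by
    rw [pow_mul]
    exact V.pow_mem ((pow_mem_iff_orderOf_dvd v e).mpr (by rw [he_def])) m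
  have h2 : F ^ (p ^ r * (p ^ (M + 1) * q)) ∈ V := by
    refine hM ((mem_localSubgroup_layerSubgroup_iff v κ M _).mpr ?_)
    rw [map_pow, map_pow, toAdd_pow, nsmul_eq_mul]
    refine Dvd.dvd.mul_right ?_ _
    push_cast
    exact Dvd.dvd.mul_left (Dvd.dvd.mul_right (pow_dvd_pow (p : ℤ_[p]) (Nat.le_succ M)) _) _
  have hFpr : F ^ (p ^ r) ∈ V := by
    have hexp : e * m = p ^ r * (p ^ (M + 1) * q) + p ^ r := by rw [hee', mul_assoc, hdecomp]; ring
    have : F ^ (p ^ r) = (F ^ (p ^ r * (p ^ (M + 1) * q)))⁻¹ * F ^ (e * m) := by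
      rw [hexp, pow_add F (p ^ r * (p ^ (M + 1) * q)) (p ^ r), inv_mul_cancel_left]
    rw [this]
    exact V.mul_mem (V.inv_mem h2) h1
  -- hence `e ∣ p^r`, so `e' = 1`
  have hdvd : e ∣ p ^ r := (pow_mem_iff_orderOf_dvd v (p ^ r)).mp hFpr
  rw [hee'] at hdvd
  have he'1 : e' = 1 := Nat.eq_one_of_dvd_one (Nat.dvd_of_mul_dvd_mul_left (pow_pos hp.pos r) (by simpa using hdvd))
  exact ⟨r, by rw [he, hee', he'1, mul_one]⟩

/-- **B5a″ (pro-prime-to-`p`): every open subgroup `W ⊇ I_𝔐` of `Γ_{K_v}` meets `D_∞` in a subgroup of index prime to `p`**, provided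
`F ∉ D_∞` (no complete splitting of `v ∤ p` in the `ℤ_p`-tower; automatic for the cyclotomic tower). Classically
`D_∞/I_𝔐 = Gal(K_v^{nr}/K_{∞,η}) ≅ ∏_{ℓ ≠ p} ℤ_ℓ`. Proof ((L2)–(L4) of the memo): `[Γ : W] = p^s f'` with `p ∤ f'`; `V = W ⊔ D_∞` has index `p^r`
((F1)), `r ≤ s`; writing `F^{p^r} = w·d` and `w = F^j τ u` modulo a deep layer shows `r ≥ s` by a `p`-adic divisibility count; then
`[D_∞ : W ⊓ D_∞] = [W ⊔ D_∞ : W] = f'`. Feeds `resOfLe_injective_of_forall_isOpen_sup_coprime` (`…PTDeepCoprimeRes`).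
[cite: GreenbergLNM1716, §2 (p. 70: "Gal((K_∞)_η^{unr}/(K_∞)_η) has profinite order prime to p")] [cite: NeukirchANT1999, Ch. II §9 Prop. (9.9)–(9.11)] -/
theorem relIndex_localSubgroup_kerSubgroup_coprime (hpv : (p : 𝓞 K) ∉ v.asIdeal) (h𝔐 : 𝔐 ∈ v.localPrimesAbove)
    (hF : IsArithFrobAt (v.adicCompletionIntegers K) F 𝔐)
    (hFD : F ∉ localSubgroup κ.kerSubgroup (v.adicCompletion K))
    {W : Subgroup (absoluteGaloisGroup (v.adicCompletion K))}
    (hIW : 𝔐.inertia (absoluteGaloisGroup (v.adicCompletion K)) ≤ W) (hW : IsOpen (W : Set (absoluteGaloisGroup (v.adicCompletion K)))) :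
    ((W ⊓ localSubgroup κ.kerSubgroup (v.adicCompletion K)).relIndex (localSubgroup κ.kerSubgroup (v.adicCompletion K))).Coprime p := by
  classical
  have hp : p.Prime := Fact.out
  haveI : CompactSpace (absoluteGaloisGroup (v.adicCompletion K)) := absoluteGaloisGroup_compactSpace (v.adicCompletion K)
  haveI : TotallyDisconnectedSpace (absoluteGaloisGroup (v.adicCompletion K)) := by
    change TotallyDisconnectedSpace (AlgebraicClosure (v.adicCompletion K) ≃ₐ[v.adicCompletion K] AlgebraicClosure (v.adicCompletion K))
    infer_instance
  -- notation
  set D : Subgroup (absoluteGaloisGroup (v.adicCompletion K)) := localSubgroup κ.kerSubgroup (v.adicCompletion K) with hD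
  set I : Subgroup (absoluteGaloisGroup (v.adicCompletion K)) := 𝔐.inertia (absoluteGaloisGroup (v.adicCompletion K)) with hI
  have hID : I ≤ D := inertia_le_localSubgroup_kerSubgroup v κ hpv h𝔐
  haveI : W.Normal := normal_of_inertia_le_local v h𝔐 hIW
  haveI : D.Normal := normal_of_inertia_le_local v h𝔐 hID
  haveI : W.FiniteIndex := finiteIndex_of_isOpen_of_compactSpace W hW
  -- the additive character `χ = toAdd ∘ κ ∘ res`
  set χ : absoluteGaloisGroup (v.adicCompletion K) → ℤ_[p] :=
    fun σ ↦ (κ (resGal (K := K) (v.adicCompletion K) σ)).toAdd with hχ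
  have hχmul : ∀ x y, χ (x * y) = χ x + χ y := fun x y ↦ by simp only [hχ, map_mul, toAdd_mul]
  have hχpow : ∀ (x) (n : ℕ), χ (x ^ n) = (n : ℤ_[p]) * χ x := fun x n ↦ by
    simp only [hχ, map_pow, toAdd_pow, nsmul_eq_mul]
  have hχD : ∀ σ, σ ∈ D ↔ χ σ = 0 := fun σ ↦ mem_localSubgroup_kerSubgroup_iff v κ σ
  have hχDM : ∀ (M : ℕ) (σ), σ ∈ localSubgroup (κ.layerSubgroup M) (v.adicCompletion K) ↔ (p : ℤ_[p]) ^ M ∣ χ σ :=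
    fun M σ ↦ mem_localSubgroup_layerSubgroup_iff v κ M σ
  set a : ℤ_[p] := χ F with ha_def
  have ha : a ≠ 0 := fun h ↦ hFD ((hχD F).mpr h)
  -- `f = [Γ : W] = p^s f'`
  set f : ℕ := orderOf (QuotientGroup.mk F : absoluteGaloisGroup (v.adicCompletion K) ⧸ W) with hf_def
  have hf : W.index = f := index_eq_orderOf_mk_frobenius v h𝔐 hF hW hIW
  have hf0 : f ≠ 0 := by rw [← hf]; exact Subgroup.FiniteIndex.index_ne_zero
  obtain ⟨s, f', hf', hff'⟩ := Nat.exists_eq_pow_mul_and_not_dvd hf0 p hp.one_lt.ne'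
  -- `V = W ⊔ D`, open, of index `p^r`
  have hVopen : IsOpen (((W ⊔ D : Subgroup (absoluteGaloisGroup (v.adicCompletion K)))) : Set (absoluteGaloisGroup (v.adicCompletion K))) :=
    Subgroup.isOpen_mono le_sup_left hW
  obtain ⟨r, hr⟩ := exists_index_eq_prime_pow v κ hpv h𝔐 hF hVopen le_sup_right
  -- `r ≤ s`
  have hrs : r ≤ s := by
    have h1 : (W ⊔ D).index ∣ W.index := Subgroup.index_dvd_of_le le_sup_left
    rw [hr, hf, hff'] at h1
    have h2 : p ^ r ∣ p ^ s :=
      (Nat.Coprime.pow_left r ((Nat.Prime.coprime_iff_not_dvd hp).mpr hf')).dvd_of_dvd_mul_right h1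
    exact (Nat.pow_dvd_pow_iff_le_right hp.one_lt).mp h2
  -- `r ≥ s`: `F^{p^r} ∈ W ⊔ D = W * D`
  have hsr : s ≤ r := by
    by_contra hlt'
    have hlt : r < s := Nat.lt_of_not_le hlt'
    haveI : (W ⊔ D).Normal := Subgroup.sup_normal W D
    haveI : (W ⊔ D).FiniteIndex := finiteIndex_of_isOpen_of_compactSpace _ hVopen
    have hIV : I ≤ W ⊔ D := hIW.trans le_sup_left
    have hFpr : F ^ (p ^ r) ∈ W ⊔ D := by
      rw [pow_mem_iff_orderOf_dvd v (p ^ r), ← index_eq_orderOf_mk_frobenius v h𝔐 hF hVopen hIV, hr]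
    have hFpr' : F ^ (p ^ r) ∈ ((W ⊔ D : Subgroup (absoluteGaloisGroup (v.adicCompletion K))) : Set (absoluteGaloisGroup (v.adicCompletion K))) := hFpr
    rw [Subgroup.normal_mul] at hFpr'
    obtain ⟨w, hw, d, hd, hwd⟩ := Set.mem_mul.mp hFpr'
    -- a deep layer: `N = s + t + 1`, `t = v_p(a)`, and an open normal `U₀ ≤ W ⊓ D_N`
    set t : ℕ := a.valuation with ht
    set N : ℕ := s + t + 1 with hN
    have hopen' : IsOpen ((W : Set (absoluteGaloisGroup (v.adicCompletion K))) ∩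
        (localSubgroup (κ.layerSubgroup N) (v.adicCompletion K) : Set (absoluteGaloisGroup (v.adicCompletion K)))) :=
      hW.inter (isOpen_localSubgroup_layerSubgroup (v.adicCompletion K) κ N)
    obtain ⟨U₀, hU₀⟩ := ProfiniteGrp.exist_openNormalSubgroup_sub_open_nhds_of_one hopen' ⟨W.one_mem, Subgroup.one_mem _⟩
    obtain ⟨j, τ, u, hτ, hu, hwdec⟩ := exists_eq_frobenius_pow_mul_inertia_mul v h𝔐 hF U₀.isOpen w
    have huW : u ∈ W := (hU₀ hu).1
    have huN : u ∈ localSubgroup (κ.layerSubgroup N) (v.adicCompletion K) := (hU₀ hu).2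
    -- `F^j ∈ W`, hence `f ∣ j`, hence `p^s ∣ j`
    have hFj : F ^ j ∈ W := by
      have e : F ^ j = w * u⁻¹ * τ⁻¹ := by rw [hwdec]; group
      rw [e]
      exact W.mul_mem (W.mul_mem hw (W.inv_mem huW)) (W.inv_mem (hIW hτ))
    have hpsj : p ^ s ∣ j := by
      have : f ∣ j := (pow_mem_iff_orderOf_dvd v j).mp hFj
      rw [hff'] at this
      exact (Dvd.intro _ rfl).trans this
    -- the character identity `p^r • a = j • a + χ u`
    have hχw : χ w = (j : ℤ_[p]) * a + χ u := by
      rw [hwdec, hχmul, hχmul, hχpow, (hχD τ).mp (hID hτ), add_zero]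
    have hχFpr : χ (F ^ (p ^ r)) = χ w := by
      rw [← hwd, hχmul, (hχD d).mp hd, add_zero]
    have hkey : χ u = (((p : ℤ) ^ r - j : ℤ) : ℤ_[p]) * a := by
      have h1 : ((p ^ r : ℕ) : ℤ_[p]) * a = (j : ℤ_[p]) * a + χ u := by rw [← hχpow, hχFpr, hχw]
      push_cast at h1 ⊢
      linear_combination -h1
    -- `p^N ∣ χ u = (p^r - j) · u₀ · p^t`
    have hdivN : (p : ℤ_[p]) ^ N ∣ χ u := (hχDM N u).mp huN
    rw [hkey, PadicInt.unitCoeff_spec ha, ← ht] at hdivN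
    -- cancel `p^t` and the unit
    have hdiv2 : (p : ℤ_[p]) ^ (s + 1) ∣ (((p : ℤ) ^ r - j : ℤ) : ℤ_[p]) := by
      have hpt : (p : ℤ_[p]) ^ t ≠ 0 := pow_ne_zero _ (by exact_mod_cast hp.ne_zero)
      have h1 : (p : ℤ_[p]) ^ (s + 1) * (p : ℤ_[p]) ^ t ∣
          ((((p : ℤ) ^ r - j : ℤ) : ℤ_[p]) * (PadicInt.unitCoeff ha : ℤ_[p])) * (p : ℤ_[p]) ^ t := by
        rw [hN, show s + t + 1 = (s + 1) + t by omega, pow_add, ← mul_assoc] at hdivN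
        exact hdivN
      have h2 : (p : ℤ_[p]) ^ (s + 1) ∣ (((p : ℤ) ^ r - j : ℤ) : ℤ_[p]) * (PadicInt.unitCoeff ha : ℤ_[p]) :=
        (mul_dvd_mul_iff_right hpt).mp h1
      exact (Units.dvd_mul_right).mp h2
    have hint : ((p : ℤ) ^ (s + 1)) ∣ (p : ℤ) ^ r - j := by
      have := (PadicInt.pow_p_dvd_int_iff (s + 1) ((p : ℤ) ^ r - j)).mp hdiv2
      exact_mod_cast this
    -- `p^{r+1} ∣ j` and `p^{r+1} ∣ p^r - j`, so `p^{r+1} ∣ p^r`: absurd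
    have h3 : ((p : ℤ) ^ (r + 1)) ∣ (j : ℤ) := by
      have : ((p ^ s : ℕ) : ℤ) ∣ (j : ℤ) := Int.natCast_dvd_natCast.mpr hpsj
      push_cast at this
      exact (pow_dvd_pow (p : ℤ) (by omega)).trans this
    have h4 : ((p : ℤ) ^ (r + 1)) ∣ (p : ℤ) ^ r - j := (pow_dvd_pow (p : ℤ) (by omega)).trans hint
    have h5 : ((p : ℤ) ^ (r + 1)) ∣ (p : ℤ) ^ r := by
      have := dvd_add h4 h3
      rwa [sub_add_cancel] at this
    have h6 : p ^ (r + 1) ∣ p ^ r := by exact_mod_cast h5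
    have h7 := (Nat.pow_dvd_pow_iff_le_right hp.one_lt).mp h6
    omega
  have hrs' : r = s := le_antisymm hrs hsr
  -- (L4) the index computation
  have hx : (W ⊓ D).relIndex D = W.relIndex D := Subgroup.inf_relIndex_right W D
  have hx2 : W.relIndex D = W.relIndex (W ⊔ D) := (Subgroup.relIndex_sup_left (K := W) (H := D)).symm
  have hx3 : W.relIndex (W ⊔ D) * (W ⊔ D).index = W.index := Subgroup.relIndex_mul_index le_sup_left
  rw [hr, hf, hff', hrs'] at hx3
  have hx4 : W.relIndex (W ⊔ D) = f' := by
    have hps : p ^ s ≠ 0 := pow_ne_zero _ hp.ne_zero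
    have : W.relIndex (W ⊔ D) * p ^ s = f' * p ^ s := by rw [hx3, mul_comm]
    exact Nat.eq_of_mul_eq_mul_right (Nat.pos_of_ne_zero hps) this
  rw [hx, hx2, hx4]
  exact ((Nat.Prime.coprime_iff_not_dvd hp).mpr hf').symm

end Tower

end SignedLowerOffTwo.PTDeep

end Summit.BirchSwinnertonDyer.BirchSwinnertonDyer.Theorems

end
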